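import Summits.ResolutionOfSingularities.ResolutionOfSingularities.Theorems.FrobeniusLadderFInjectiveMacaulayficationE8OffCentreRegular
import Summits.ResolutionOfSingularities.ResolutionOfSingularities.Theorems.FrobeniusLadderFInjectiveMacaulayficationE7OffCentreRegular
import Mathlib.Algebra.MvPolynomial.PDeriv
import Mathlib.Algebra.CharP.Lemmas
import HarnessLib

/-!
# `E₈⁰` in characteristic `3` is regular off the origin

Support file for crux stmt-ResolutionOfSingularities-15315
(`FrobeniusLadder.FInjectiveMacaulayfication`, line `Sketch`, seat c5): stub
`stub_e8OffCentreRegularChar3` — the characteristic-`3` counterpart of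
`E8OffCentreRegular.stub_e8OffCentreRegular` (characteristic `5`), needed for the second step of
the characteristic-`3` tower for `E₈⁰` on the non-affine base `X₁ = Bl_𝔪 E₈⁰`: off the exceptional
divisor the points of `X₁` are the local rings `R_P` of `R = k[X₀,X₁,X₂]/(f)`,
`f = X₂² + X₀³ + X₁⁵`, at primes `P ⊉ 𝔪 = (x̄, ȳ, z̄)`.

In characteristic `3` the derivative `∂f/∂X₀ = 3X₀²` used by the characteristic-`5` template
vanishes, so the case analysis runs through `∂f/∂X₂ = 2X₂` and `∂f/∂X₁ = 5X₁⁴` instead (`2` and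
`5` are units in characteristic `3`), with the Jacobian criterion in its regular direction at an
arbitrary prime (tree theorem `HypersurfaceRegular.stub_hypersurfaceRegularOfPderiv`,
Matsumura Thm. 30.4 (ii)).

What is proved:

* `pderiv_one_e8` — `∂f/∂X₁ = 5 X₁⁴` (over any commutative ring); `∂f/∂X₂ = 2 X₂` is the imported
  `E8OffCentreRegular.pderiv_two_e8`.
* `five_ne_zero_of_charP_three` — `5 ≠ 0` in a field of characteristic `3`
  (`CharP.cast_eq_zero_iff`); `2 ≠ 0` is the imported `E7OffCentreRegular.two_ne_zero_of_charP_three`.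
* `stub_e8OffCentreRegularChar3` — the registered form. With `P₀ = P ∩ S ∋ f`: if `X₂ ∉ P₀` then
  `∂f/∂X₂ = 2X₂ ∉ P₀` (`2` a unit), so `R_P` is regular by the Jacobian criterion with `i = 2`;
  else if `X₁ ∉ P₀` then `∂f/∂X₁ = 5X₁⁴ ∉ P₀` (`5` a unit, `P₀` prime), Jacobian criterion with
  `i = 1`; else `X₁, X₂ ∈ P₀` and `f ∈ P₀` give `X₀³ ∈ P₀`, hence `X₀ ∈ P₀`, so `𝔪 ≤ P` —
  excluded by hypothesis.

References: H. Matsumura, *Commutative Ring Theory*, Cambridge Stud. Adv. Math. 8, CUP 1986,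
Thm. 30.4 (ii) [Matsumura1987] (through the imported Jacobian criterion); M. Artin, *Coverings of
the rational double points in characteristic `p`*, in: Complex Analysis and Algebraic Geometry,
Iwanami Shoten 1977 [Artin1977] (the form `E₈⁰`, context only). The computation itself is
folklore.
-/

-- single-problem summit: the doubled namespace component is forced
set_option linter.dupNamespace false

noncomputable section

namespace Summit.ResolutionOfSingularities.ResolutionOfSingularities.Theorems.FInjectiveMacaulayfication.E8OffCentreRegularChar3

open MvPolynomial

/-- **`∂f/∂X₁ = 5X₁⁴`** for `f = X₂² + X₀³ + X₁⁵`, over any commutative ring: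
`∂X₂/∂X₁ = ∂X₀/∂X₁ = 0`, `∂X₁⁵/∂X₁ = 5X₁⁴` (`MvPolynomial.pderiv_pow`, `pderiv_X_self`,
`pderiv_X_of_ne`). [folklore] -/
theorem pderiv_one_e8 {A : Type*} [CommRing A] :
    pderiv 1 (X 2 ^ 2 + X 0 ^ 3 + X 1 ^ 5 : MvPolynomial (Fin 3) A) = C 5 * X 1 ^ 4 := by
  simp only [map_add, pderiv_pow, pderiv_X_self,
    pderiv_X_of_ne (show (2 : Fin 3) ≠ 1 by decide),
    pderiv_X_of_ne (show (0 : Fin 3) ≠ 1 by decide),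
    mul_zero, zero_add, mul_one]
  rw [map_ofNat]
  norm_num

/-- **`5 ≠ 0` in characteristic `3`**: `(5 : k) = 0` would force `3 ∣ 5` (`CharP.cast_eq_zero_iff`).
[folklore] -/
theorem five_ne_zero_of_charP_three {k : Type*} [Field k] [CharP k 3] : (5 : k) ≠ 0 := by
  intro h
  have h' : ((5 : ℕ) : k) = 0 := by exact_mod_cast h
  rw [CharP.cast_eq_zero_iff k 3 5] at h'
  omega

/-- **`E₈⁰` in characteristic `3` is regular off the origin** (registered stub
`stub_e8OffCentreRegularChar3`): for a field `k` of characteristic `3`,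
`f = X₂² + X₀³ + X₁⁵ ∈ S = k[X₀,X₁,X₂]`, `R = S/(f)`, and a prime `P` of `R` not containing
`𝔪 = (x̄, ȳ, z̄)`, the local ring `R_P` is regular. Proof: let `P₀ = P ∩ S`, a prime containing
`f`. If `X₂ ∉ P₀`, then `∂f/∂X₂ = 2X₂ ∉ P₀` (`2` is a unit, `E8OffCentreRegular.mem_of_C_mul_mem`),
and the Jacobian criterion (`HypersurfaceRegular.stub_hypersurfaceRegularOfPderiv`, `i = 2`)
applies; if `X₂ ∈ P₀` but `X₁ ∉ P₀`, then `∂f/∂X₁ = 5X₁⁴ ∉ P₀` (`5` is a unit, `P₀` prime) and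
the criterion applies with `i = 1`; otherwise `X₁, X₂, f ∈ P₀` give
`X₀³ = f - X₂² - X₁⁵ ∈ P₀`, so `X₀ ∈ P₀` and `𝔪 ≤ P`, contradicting the hypothesis.
[cite: Matsumura1987, Thm. 30.4 (ii)] for the Jacobian criterion; the case analysis is
folklore. -/
theorem stub_e8OffCentreRegularChar3 : ∀ (k : Type) [Field k] [CharP k 3] (f : MvPolynomial (Fin 3) k),
    f = MvPolynomial.X 2 ^ 2 + MvPolynomial.X 0 ^ 3 + MvPolynomial.X 1 ^ 5 →
    ∀ (P : Ideal (MvPolynomial (Fin 3) k ⧸ Ideal.span {f})) [P.IsPrime],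
      ¬ Ideal.span (Set.range fun j : Fin 3 => Ideal.Quotient.mk (Ideal.span {f}) (MvPolynomial.X j)) ≤ P →
      IsRegularLocalRing (Localization.AtPrime P) := by
  intro k _ _ f hf P _ hP
  haveI hprime : (P.comap (Ideal.Quotient.mk (Ideal.span {f}))).IsPrime := Ideal.comap_isPrime _ _
  have hfP : f ∈ P.comap (Ideal.Quotient.mk (Ideal.span {f})) := by
    rw [Ideal.mem_comap, Ideal.Quotient.eq_zero_iff_mem.mpr (Ideal.mem_span_singleton_self f)]
    exact P.zero_mem
  by_cases h2 : (X 2 : MvPolynomial (Fin 3) k) ∈ P.comap (Ideal.Quotient.mk (Ideal.span {f}))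
  · by_cases h1 : (X 1 : MvPolynomial (Fin 3) k) ∈ P.comap (Ideal.Quotient.mk (Ideal.span {f}))
    · -- `X₁, X₂ ∈ P₀`: then `X₀ ∈ P₀` too, so `𝔪 ≤ P`, excluded
      exfalso
      refine hP ?_
      have h0 : (X 0 : MvPolynomial (Fin 3) k) ∈ P.comap (Ideal.Quotient.mk (Ideal.span {f})) := by
        refine hprime.mem_of_pow_mem 3 ?_
        have e : (X 0 ^ 3 : MvPolynomial (Fin 3) k) = f - X 2 ^ 2 - X 1 ^ 5 := by
          rw [hf]; ring
        rw [e]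
        exact Ideal.sub_mem _ (Ideal.sub_mem _ hfP (Ideal.pow_mem_of_mem _ h2 2 two_pos))
          (Ideal.pow_mem_of_mem _ h1 5 (by norm_num))
      rw [Ideal.span_le, Set.range_subset_iff]
      intro j
      fin_cases j
      exacts [h0, h1, h2]
    · -- `X₂ ∈ P₀`, `X₁ ∉ P₀`: Jacobian criterion with `∂f/∂X₁ = 5X₁⁴ ∉ P₀`
      refine HypersurfaceRegular.stub_hypersurfaceRegularOfPderiv k 3 f 1 P (fun hd => h1 ?_)
      have e : pderiv 1 f = C 5 * X 1 ^ 4 := by rw [hf]; exact pderiv_one_e8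
      rw [e] at hd
      exact hprime.mem_of_pow_mem 4
        (E8OffCentreRegular.mem_of_C_mul_mem _ five_ne_zero_of_charP_three hd)
  · -- `X₂ ∉ P₀`: Jacobian criterion with `∂f/∂X₂ = 2X₂ ∉ P₀`
    refine HypersurfaceRegular.stub_hypersurfaceRegularOfPderiv k 3 f 2 P (fun hd => h2 ?_)
    have e : pderiv 2 f = C 2 * X 2 := by rw [hf]; exact E8OffCentreRegular.pderiv_two_e8
    rw [e] at hd
    exact E8OffCentreRegular.mem_of_C_mul_mem _ E7OffCentreRegular.two_ne_zero_of_charP_three hd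

end Summit.ResolutionOfSingularities.ResolutionOfSingularities.Theorems.FInjectiveMacaulayfication.E8OffCentreRegularChar3

end
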